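import Mathlib.NumberTheory.ArithmeticFunction.Moebius
import Mathlib.Analysis.Complex.Basic
import Mathlib.Topology.Algebra.InfiniteSum.Basic
import HarnessLib

/-!
# Möbius orthogonality of `q`-semimultiplicative sequences (Konieczny 2020) — named fact

J. Konieczny, *Möbius orthogonality for `q`-semimultiplicative sequences*, Monatsh. Math. 192
(2020) 853–882 (`Konieczny2020`; arXiv:1808.06196, whose text we quote), vendored AS PRINTED
(CONVENTIONS §4):

* `IsSemimultiplicative q r f` — Definition 3.1 (gap `≤ r`): "The sequence `f : ℕ₀ → G` is
  `q`-semimultiplicative if there exists `r ≥ 0` such that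
  `f(n+m+k) = f(n+m) f(m)⁻¹ f(m+k)` for any `n, m, k ≥ 0` such that `k < q^l`, `q^l ∣ m`,
  `m < q^{l+r}` and `q^{l+r} ∣ n` for some `l ≥ 0`, and additionally `f(0) = id_G`. We refer to
  the least such `r` as the gap of `f`." Here `G = 𝕌 = {z ∈ ℂ : |z| = 1}` (the setting of
  Theorem 1), written for `f : ℕ → ℂ` with the unimodularity carried by the consumer, and the
  relation multiplied through by `f(m)` (equivalent for `f(m) ≠ 0`).
* `konieczny_semimultiplicative_moebius` — Theorem 1: "Let `f : ℕ₀ → 𝕌` be a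
  `q`-semimultiplicative sequence. Then `𝔼_{n<N} f(n) μ(n) → 0` as `N → ∞`"
  (`𝔼_{n<N} = (1/N) Σ_{n=0}^{N-1}`, §1 Notation; the base `q ≥ 2` is fixed throughout the paper).

Why it is here (route `QuantumAdvantage/MobiusLadder`, crux
`Summit.QuantumAdvantage.QuantumAdvantage.Theses.MobiusLadder.QuadraticDigitPhases`, and its
parent `DigitPolyUniformity`): a digital phase `f(n) = (-1)^{P(x₀, x₁, …)}`, `n = Σ_j x_j 2^j`,
with `P` an `𝔽₂`-polynomial (zero constant term) all of whose monomials have DIAMETER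
`max index - min index ≤ r`, is `2`-semimultiplicative with gap `≤ r` (the digit blocks of
`k`, `m`, `n` in Definition 3.1 are disjoint, so no monomial meets both `k` and `n`, and the
second difference `P(n+m+k) - P(n+m) - P(m+k) + P(m)` vanishes) — this observation is the
consumer's, not the paper's. Hence Theorem 1 settles, for `μ`, qualitatively and for ONE FIXED
sequence at a time, the bounded-bandwidth sub-class of those cruxes (any degree); the cruxes
themselves ask for bounds UNIFORM over all polynomials of the given degree at each length
(including unbounded-diameter forms such as `Σ x_i x_{n-1-i}`) and for `λ`, which is NOT in
print. Earlier special cases: `q`-multiplicative sequences (Indlekofer–Kátai), the Rudin–Shapiro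
sequence and block-counting phases `e(α·|n|_{11})` (Mauduit–Rivat 2015), automatic sequences
(Müllner 2017) — see the paper's §1.

What is NOT here: Theorem 2 (the dichotomy almost-periodic / Kátai–Bourgain–Sarnak–Ziegler
criterion), any rate of convergence (the theorem is qualitative), the Liouville analogue (not
stated in the paper).
-/

namespace Literature.NumberTheory.LFunctions

/-- `IsSemimultiplicative q r f`: the sequence `f : ℕ → ℂ` is `q`-semimultiplicative with gap
`≤ r` in the sense of Konieczny 2020, Definition 3.1: `f 0 = 1` and
`f(n+m+k) · f(m) = f(n+m) · f(m+k)` whenever, for some `l ≥ 0`, `k < q^l`, `q^l ∣ m`,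
`m < q^{l+r}` and `q^{l+r} ∣ n` (the digits of `k`, `m`, `n` occupy the disjoint position blocks
`[0,l)`, `[l,l+r)`, `[l+r,∞)`). Printed with `f(m)⁻¹` on the right for group-valued `f`; for
the unimodular sequences of Theorem 1 the two forms are equivalent. Every `q`-multiplicative
sequence is `q`-semimultiplicative (gap `0`), and so is `e(α·|n|_{11})` (Rudin–Shapiro type,
gap `1`). [cite: Konieczny2020, Definition 3.1] -/
def IsSemimultiplicative (q r : ℕ) (f : ℕ → ℂ) : Prop :=
  f 0 = 1 ∧ ∀ l n m k : ℕ, k < q ^ l → q ^ l ∣ m → m < q ^ (l + r) → q ^ (l + r) ∣ n →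
    f (n + m + k) * f m = f (n + m) * f (m + k)

/-- **Konieczny 2020, Theorem 1** (Möbius orthogonality of `q`-semimultiplicative sequences).
Printed statement: "Let `f : ℕ₀ → 𝕌` be a `q`-semimultiplicative sequence. Then
`𝔼_{n<N} f(n) μ(n) → 0` as `N → ∞`", where `𝕌 = {z ∈ ℂ : |z| = 1}`,
`𝔼_{n<N} = (1/N) Σ_{n=0}^{N-1}` and the base `q ≥ 2` is arbitrary but fixed. Rendered with
`f : ℕ → ℂ`, `‖f n‖ = 1`, some gap `r`, and `μ = ArithmeticFunction.moebius` (`μ(0) = 0`).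
Qualitative (no rate); `μ` only (no Liouville version is printed). Grounds the bounded-diameter
sub-class of `Summit.QuantumAdvantage.QuantumAdvantage.Theses.MobiusLadder.QuadraticDigitPhases`
/ `.DigitPolyUniformity` for `μ`, one fixed sequence at a time (see the module docstring); the
uniform statements of those cruxes are not in print. [cite: Konieczny2020, Theorem 1] -/
def konieczny_semimultiplicative_moebius : Prop :=
  ∀ (q : ℕ), 2 ≤ q → ∀ (r : ℕ) (f : ℕ → ℂ), (∀ n, ‖f n‖ = 1) → IsSemimultiplicative q r f →
    Filter.Tendsto
      (fun N : ℕ => (N : ℂ)⁻¹ * ∑ n ∈ Finset.range N, f n * (ArithmeticFunction.moebius n : ℂ))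
      Filter.atTop (nhds 0)

end Literature.NumberTheory.LFunctions
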